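import Mathlib
import HarnessLib
import Literature.Analysis.FluidPDE.ClassicalSolution

/-!
# Route `QuarterLogPincer`, crux `TypeIQuantSubcubicExp` (stmt-NavierStokesRegularity-24077), line `bead_census` —
# the line's OBJECTS, verbatim (Defs file)

VERBATIM port of the statement objects of ns-idea-7's workfile `Cruxes/TypeIQuantSubcubicExp/Lines/bead_census.lean`
(v1.2, idea-crit-4 verdict PASS 2026-08-29T04:07Z): §1 `levelScale`, `levelShell`, `GoodLevel` (levels, trace shells,
BP-regular annuli in the rate gauge) and §3/§3♯ `ChainAt`, `CensusAt`, `BPChainRate` (G2), `BeadCensus`,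
`FlarePersistenceAt`, `FlarePersistence` (G1♯), in the decl-of-record namespace `…Cruxes.TypeIQuantSubcubicExp.BeadCensus`
(the same objects are restated in `ember_census` / `silencing_cost`; this module is their importable home, as
`…CubicRungDefs` is for the rung).  Only textual change: the workfile's local notation `E3` is unfolded to
`EuclideanSpace ℝ (Fin 3)` (no notation declared).  No stub is proved here; the proved kernels of the line are ported
separately (`…BeadCensusKernel`).  HONEST FRAME: definitions of Props about HYPOTHETICAL Type-I (sup-rate) classical
solutions; `BPChainRate` / `FlarePersistence` are the line's stubs (XL published mechanism / conjectural crux-let), not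
facts; nothing here bears on 24077's truth, W7 or Navier–Stokes regularity (OPEN / not proved).  pub-ns-dss typer (g38),
`--supports stmt-NavierStokesRegularity-24077`; text by ns-idea-7 (g11–g12).
-/

set_option linter.dupNamespace false

namespace Summit.NavierStokesRegularity.NavierStokesRegularity.Cruxes.TypeIQuantSubcubicExp.BeadCensus

noncomputable section

open MeasureTheory Set Function Filter Topology Metric
open scoped ENNReal NNReal Classical
open Literature.Analysis Literature.Analysis.FluidPDE

/-- Parabolic scale of level `k` below the evaluation time `t₁`, log-separation `a` per level:
`s_k = t₁ · e^{-2ak}` (BP21: `a = M^{1023}`). -/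
def levelScale (a t₁ : ℝ) (k : ℕ) : ℝ := t₁ * Real.exp (-2 * a * k)

/-- The level-`k` TRACE SHELL about `x₀`: `4M√s_k < ‖x − x₀‖ < e^{a}√s_k` — it starts beyond similarity
radius `4M` (materially frozen, `outer_region_frozen`) and ends where level `k−1` begins; the shells of
distinct levels are disjoint once `e^{a} ≤ 4M e^{a}·e^{-a}`… precisely once `a ≥ log (4M)` they are
nested-disjoint (`levelShell_disjoint`, not needed by the kernel: disjointness is consumed inside
`stub_bpChainRate`'s summed conclusion). -/
def levelShell (M a t₁ : ℝ) (x₀ : (EuclideanSpace ℝ (Fin 3))) (k : ℕ) : Set (EuclideanSpace ℝ (Fin 3)) :=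
  {x | 4 * M * Real.sqrt (levelScale a t₁ k) < ‖x - x₀‖ ∧
    ‖x - x₀‖ < Real.exp a * Real.sqrt (levelScale a t₁ k)}

/-- **A BP-REGULAR ANNULUS at level `k`** (Barker–Prange Lemma 20 / Cor. 21, conclusion, in the rate
gauge's units): inside the level-`k` trace shell there is a radius `R` such that on
`{R < ‖x−x₀‖ < M^{10μ} R} × [t₁ − s_k/32, t₁]` the solution is quantitatively regular UP TO the
evaluation time, `‖∇ʲu‖ ≤ M^{-3μ} s_k^{-(j+1)/2}` for `j ≤ 2`. [corpus:paper:arxiv-2003.06717 p.32] -/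
def GoodLevel (M μ a : ℝ) (u : ℝ → (EuclideanSpace ℝ (Fin 3)) → (EuclideanSpace ℝ (Fin 3))) (t₁ : ℝ)
    (x₀ : (EuclideanSpace ℝ (Fin 3))) (k : ℕ) : Prop :=
  ∃ R : ℝ, 4 * M * Real.sqrt (levelScale a t₁ k) ≤ R ∧
    M ^ (10 * μ) * R ≤ Real.exp a * Real.sqrt (levelScale a t₁ k) ∧
    ∀ t ∈ Icc (t₁ - levelScale a t₁ k / 32) t₁, ∀ x : (EuclideanSpace ℝ (Fin 3)),
      R < ‖x - x₀‖ → ‖x - x₀‖ < M ^ (10 * μ) * R →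
      ∀ j : ℕ, j ≤ 2 →
        ‖iteratedFDeriv ℝ j (u t) x‖ ≤ M ^ (-(3 * μ)) * (levelScale a t₁ k) ^ (-(((j : ℝ) + 1) / 2))

/-- `ChainAt M μ a b c`: BP's chain at Type-I constant `M` with smallness exponent `μ`, level separation
`a`, seed loss `b`, deposit `c` — a violator `e^{a(n+1)} A^{b} ≤ ‖u(t₁,x₀)‖√t₁` yields `n` levels and
every GOOD level deposits `≥ c` into its own (disjoint) trace shell at time `t₁`: `#good · c ≤ A³`. -/
def ChainAt (M μ a b c : ℝ) : Prop :=
  ∀ (T τ A t₁ : ℝ) (x₀ : (EuclideanSpace ℝ (Fin 3))) (u : ℝ → (EuclideanSpace ℝ (Fin 3)) → (EuclideanSpace ℝ (Fin 3)))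
    (p : ℝ → (EuclideanSpace ℝ (Fin 3)) → ℝ) (n : ℕ),
    (IsClassicalNSSolutionOn (Icc 0 T) 1 0 u p ∧
        ∀ m : ℕ, ∃ C : NNReal, ∀ t ∈ Icc 0 T, eLpNorm (iteratedFDeriv ℝ m (u t)) 2 volume ≤ C) →
      0 < τ →
      (∀ t ∈ Icc 0 T, ∀ x : (EuclideanSpace ℝ (Fin 3)), ‖u t x‖ ≤ M * (T + τ - t) ^ (-(1 / 2 : ℝ))) →
      (∀ t ∈ Icc 0 T, eLpNorm (u t) 3 volume ≤ ENNReal.ofReal A) → 2 ≤ A →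
      t₁ ∈ Ioc 0 T → Real.exp (a * (n + 1) + b * Real.log A) ≤ ‖u t₁ x₀‖ * Real.sqrt t₁ →
      (((Finset.range n).filter fun k => GoodLevel M μ a u t₁ x₀ (k + 1)).card : ℝ) * c ≤ A ^ 3

/-- `CensusAt M μ a C`: about ANY point and for ANY depth `n`, at most `C·A³` of the levels `1..n` are
BAD (no BP-regular annulus in their trace shell). -/
def CensusAt (M μ a C : ℝ) : Prop :=
  ∀ (T τ A t₁ : ℝ) (x₀ : (EuclideanSpace ℝ (Fin 3))) (u : ℝ → (EuclideanSpace ℝ (Fin 3)) → (EuclideanSpace ℝ (Fin 3)))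
    (p : ℝ → (EuclideanSpace ℝ (Fin 3)) → ℝ) (n : ℕ),
    (IsClassicalNSSolutionOn (Icc 0 T) 1 0 u p ∧
        ∀ m : ℕ, ∃ C : NNReal, ∀ t ∈ Icc 0 T, eLpNorm (iteratedFDeriv ℝ m (u t)) 2 volume ≤ C) →
      0 < τ →
      (∀ t ∈ Icc 0 T, ∀ x : (EuclideanSpace ℝ (Fin 3)), ‖u t x‖ ≤ M * (T + τ - t) ^ (-(1 / 2 : ℝ))) →
      (∀ t ∈ Icc 0 T, eLpNorm (u t) 3 volume ≤ ENNReal.ofReal A) → 2 ≤ A →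
      t₁ ∈ Ioc 0 T →
      (((Finset.range n).filter fun k => ¬ GoodLevel M μ a u t₁ x₀ (k + 1)).card : ℝ) ≤ C * A ^ 3

/-- **G2 — `BPChainRate` (size XL; PUBLISHED MECHANISMS, rate gauge; no wall): Barker–Prange's chain
GIVEN the annuli.**  There are `μ > 0`, `M₀ ≥ 1`, `b ≥ 0` (v1.2, critic N2: the intended regime typed — for `μ ≤ 0` or
`M < 1` the annulus in `GoodLevel` degenerates) and, for `M ≥ M₀`, `a₁ = a₁(M) > 0`, `c = c(M) > 0` with
`ChainAt M μ a b c` for EVERY level separation `a ≥ a₁` (BP21: `a₁ = M^{1023}`; sparser levels only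
mean fewer levels per violator, each still depositing `c`): SEED — Tao's global regularity mechanism turns the violator into a frequency bubble
`N₀^{-1}|P_{N₀}u(x₀,t₁)| > A^{-O(1)}` with `N₀√t₁ ≳ e^{a(n+1)}` (the factor `A^{b} = e^{b log A}` is this
seed loss) [Tao19 Thm 5.1 / Prop 3.2 as quoted in corpus:paper:arxiv-2003.06717 p.5]; LEVELS — backward
propagation of concentration to every coarser scale `s_k = t₁e^{-2ak}`, `k ≤ n` (BP Lemma 4, whose only
use of `L^{3,∞}` is `L²_uloc` = the LEAD's registered (I1) `UniformScaledEnergy` in the rate gauge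
[p.12, p.26]); epochs free (Lemma 27 [p.34]); DEPOSIT — at a GOOD level the two Carleman inequalities
across the BP-regular annulus give `∫_{shell_k}|u(t₁)|³ ≥ c := exp(-exp(M^{O(1)}))` [p.14–18 Steps
1–4]; SUM — the trace shells of distinct levels are disjoint, `#good·c ≤ ‖u(t₁)‖₃³ ≤ A³` [p.18 Step
4/5].  Why it might fail: not as mathematics — every step is in print with the annulus as its only
gauge-sensitive input, here moved into the hypothesis `GoodLevel`; the risk is porting cost (XL) and
bookkeeping of constants. -/
def BPChainRate : Prop :=
  ∃ μ M₀ b : ℝ, 0 < μ ∧ 1 ≤ M₀ ∧ 0 ≤ b ∧ ∀ M : ℝ, M₀ ≤ M →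
    ∃ a₁ c : ℝ, 0 < a₁ ∧ 0 < c ∧ ∀ a : ℝ, a₁ ≤ a → ChainAt M μ a b c

/-- **`BeadCensus`** (v1.2: DERIVED from G1♯ `FlarePersistence` by `beadCensus_of_flarePersistence`;
regime `μ > 0`, `M ≥ 1` typed per critic N2): for every such `(μ, M)` and every level
separation `a ≥ a₀(μ, M)` (below `a = log(4M^{1+10μ})` the annulus range in `GoodLevel` is empty and
every level is trivially bad) there is `C` with `CensusAt M μ a C`.**  Heuristic FOR: the trace shells start beyond similarity radius `4M`, hence are
materially frozen (`outer_region_frozen` — a lever that exists only in the sup-rate gauge); activity in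
shell `k` during the level-`k` window deposits into shell `k`'s final trace (LEAD (I2) final-window
continuity); the shells are disjoint and share `∫|u|³ ≤ A³`; seeds of small scale-invariant energy
cannot flare (ε-regularity).  Why it might fail: BURN-OUT FLARES — transient Type-I-amplitude events in
outer shells whose final trace falls below the deposit threshold; a smooth Type-I family with unboundedly
many of them in disjoint shells at fixed `(M, A)` refutes `BeadCensus` (the rung R survives via
`cubic_rung`).  Persistent beads (satellite singular points, necklaces `λ^k x₁ → x₀`) cost `≥ ε₀` of
trace each — at most `A³/ε₀`, harmless.  Sources: [corpus:paper:arxiv-2003.06717 p.32 Lemma 20 /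
Cor. 21 (the step replaced)], ε-regularity [CaffarelliKohnNirenberg1982], LEAD (I2)
`Theorems/QuarterLogPincerTypeIQuantSubcubicExpTruncationEdge*.lean`. -/
def BeadCensus : Prop :=
  ∀ μ M : ℝ, 0 < μ → 1 ≤ M → ∃ a₀ : ℝ, ∀ a : ℝ, a₀ ≤ a → ∃ C : ℝ, CensusAt M μ a C

/-- `FlarePersistenceAt M μ a c` — **the typed gap of the census**: in the crux's frame at Type-I
constant `M`, a BAD level `k+1` about `x₀` (no BP-regular annulus anywhere in its trace shell during its
window) has left at least `c` of CUBE TRACE in that shell AT THE EVALUATION TIME `t₁`: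
`c ≤ ∫_{levelShell (k+1)} |u(t₁)|³`.  Informally: a Type-I flare at scale `√s` inside a materially frozen
shell cannot burn out below trace `c(M, μ, a)` within time `s/32` — short-time `L³` PERSISTENCE at
Reynolds number `M`.  KNOWN for small scale-invariant energy (ε-regularity: such seeds do not flare at
all) and for persistent beads (satellite singular points / necklaces carry `≥ ε₀` of trace); OPEN in
general.  Why it might fail: BURN-OUT FLARES — a bad level is bad because EVERY candidate annulus
`{R < |x−x₀| < M^{10μ}R}` of the shell sees a violation at some time of the window, i.e. `≳ a/(10μ log M)`
well-separated CKN-concentration events, each of which may live at a tiny scale `r` (cube mass `∼ ε`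
at time `t`, lifetime `∼ r²`) and dissipate before `t₁`; a family with such flares of total final trace
`→ 0` at fixed `(M, μ, a)` refutes `FlarePersistenceAt M μ a c` for every `c > 0`.  This statement is
STRONGER than the census (`censusAt_of_flarePersistenceAt` below; the census could survive its failure
only by a counting accident) and is the typed target of the line's cheapest falsifier (instrument row
«outer-shell flare census»).  Sources: [corpus:paper:arxiv-2003.06717 p.32 Lemma 20 / Cor. 21 (the step
it replaces), p.18 Step 4 (disjoint-shell summation)], ε-regularity [CaffarelliKohnNirenberg1982], LEAD
(I2) `Theorems/QuarterLogPincerTypeIQuantSubcubicExpTruncationEdge*.lean` (final-window continuity). -/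
def FlarePersistenceAt (M μ a c : ℝ) : Prop :=
  ∀ (T τ A t₁ : ℝ) (x₀ : (EuclideanSpace ℝ (Fin 3))) (u : ℝ → (EuclideanSpace ℝ (Fin 3)) → (EuclideanSpace ℝ (Fin 3)))
    (p : ℝ → (EuclideanSpace ℝ (Fin 3)) → ℝ) (k : ℕ),
    (IsClassicalNSSolutionOn (Icc 0 T) 1 0 u p ∧
        ∀ m : ℕ, ∃ C : NNReal, ∀ t ∈ Icc 0 T, eLpNorm (iteratedFDeriv ℝ m (u t)) 2 volume ≤ C) →
      0 < τ →
      (∀ t ∈ Icc 0 T, ∀ x : (EuclideanSpace ℝ (Fin 3)), ‖u t x‖ ≤ M * (T + τ - t) ^ (-(1 / 2 : ℝ))) →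
      (∀ t ∈ Icc 0 T, eLpNorm (u t) 3 volume ≤ ENNReal.ofReal A) → 2 ≤ A →
      t₁ ∈ Ioc 0 T → ¬ GoodLevel M μ a u t₁ x₀ (k + 1) →
      ENNReal.ofReal c ≤ ∫⁻ x in levelShell M a t₁ x₀ (k + 1), ‖u t₁ x‖ₑ ^ (3 : ℝ)

/-- **G1♯ — `FlarePersistence` (the CRUX-LET, v1.2; conjectural; no wall):** in the intended regime
`μ > 0`, `M ≥ 1`, for every level separation `a ≥ a₀(μ,M) ≥ 0` there is a deposit `c = c(M,μ,a) > 0` with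
`FlarePersistenceAt M μ a c`. -/
def FlarePersistence : Prop :=
  ∀ μ M : ℝ, 0 < μ → 1 ≤ M → ∃ a₀ : ℝ, 0 ≤ a₀ ∧ ∀ a : ℝ, a₀ ≤ a →
    ∃ c : ℝ, 0 < c ∧ FlarePersistenceAt M μ a c

end

end Summit.NavierStokesRegularity.NavierStokesRegularity.Cruxes.TypeIQuantSubcubicExp.BeadCensus
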